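import Mathlib
import Literature.Probability.Percolation.CLE6
import Literature.Probability.Percolation.InterfaceLoopPolygon
import Literature.Probability.Percolation.SitePaths
import Literature.Probability.Percolation.FullPlaneCNL
import Literature.Probability.Percolation.LoopRepresentation
import Literature.Probability.LatticeModels.TriangularLatticeProofs
import Summits.CriticalPhenomena.CardyFormulaZ2.Theorems.CardyMagicRigidityHexSegmentDefs
import Summits.CriticalPhenomena.CardyFormulaZ2.Theorems.CardyMagicRigidityLoopLimitZ2EqTSiteEndCoupling
import Summits.CriticalPhenomena.CardyFormulaZ2.Theorems.CardyMagicRigidityLoopLimitZ2EqTSiteEndDictionary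
import HarnessLib

/-!
# Stub `stub_siteEnd` (S2) of line `Sketch`, crux `LoopLimitZ2EqT` (stmt-CriticalPhenomena-4833):
# S2 reduced to the combinatorial fellow-travelling of corresponding interface loops

Helper file (`--supports stmt-CriticalPhenomena-4833`), the last link of the reduction chain
`SiteEndLoops ⇐ (M1) ∧ (M0)` (`siteEnd_of_metric`, `…SiteEndDictionary.lean`)
`⇐ (CFT1) ∧ (CFT0)` (this file, through the discrete Fréchet bound
`siteEnd_udist_siteLoopCurve_le_of_coupling` of `…SiteEndCoupling.lean`):

* `siteEnd_dist_two_hexCenter_le` — `dist (2 · hexCenter (X, A)) (hexCenter (y, b)) ≤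
  |y₀ - 2X₀| + |y₁ - 2X₁| + 2`: the metric hypothesis of (CFT1)/(CFT0) from integer coordinate
  bounds (the fine cell in a bounded box around the doubled coarse cell);
* `siteEnd_udist_le_of_lattice_coupling` — a unit-step coupling of the face sequences of a
  coarse closed walk `Γ` and of a rebasing `γ'` of a fine closed walk `γ` with
  `dist (2 · hexCenter Γ_{i_k}) (hexCenter γ'_{j_k}) ≤ C` (lattice units) gives
  `udist (Γ at mesh δ) (γ at mesh δ/2) ≤ (C/2) δ`;
* `siteEnd_metric_one_of_cft`, `siteEnd_metric_zero_of_cft` — (M1) from (CFT1), (M0) from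
  (CFT0);
* `siteEnd_fine_hexDart_mem_darts` — a synchronised pair of starting darts for (CFT1): with
  `c` a rightmost cell of the left cluster of `Γ` (`hexDart c 5 ∈ Γ.darts`,
  `siteEnd_hexDart_mem_darts`), the fine loop `γ` contains `hexDart (2c + (2,0)) 5` (the pendant
  corner `2(c + e₀)` is a rightmost site of its left cluster);
* **`siteEnd_of_cft`** — `SiteEndLoops` from (CFT1) ∧ (CFT0).

**What remains for `stub_siteEnd`** is therefore the purely combinatorial statement (CFT1) (and
its type-`0` twin (CFT0)): for a type-`1` interface loop `Γ` of a cell set `τ` and a type-`1`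
interface loop `γ` of the blow-up `β τ = {v | (∀ i, 2 ∣ v i) ∨ ⌊v/2⌋ ∈ τ}` whose left cluster
contains the block centre `2·lv₀(Γ) + (1,1)`, some rebasing `γ'` of `γ` (same unbased loop at
every mesh, e.g. `IsSiteInterfaceLoop.exists_rebase`) and `Γ` admit unit-step index sequences
`i, j` from the base faces to the base faces along which `dist (2 · hexCenter (Γ.getVert (i k)))
(hexCenter (γ'.getVert (j k))) ≤ C`, with `C` absolute. (By the loops ↔ clusters dictionary,
`Γ` is the outer boundary of the finite open cluster `C₀` of `lv₀(Γ)` and `γ` the outer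
boundary of the fine cluster of its blow-up, `…SiteEndOuterBoundary.lean`,
`…SiteEndClusters.lean`; the expected proof is a local analysis of the fine interface between
the blown-up blocks, each coarse step expanding into boundedly many fine steps.)
-/

noncomputable section

open Set Metric Complex

namespace Summit.CriticalPhenomena.CardyFormulaZ2.Cruxes.LoopLimitZ2EqT.HexSegment

open Literature.Probability.Percolation Literature.Probability.LatticeModels
  Literature.Probability.RandomPlanarGeometry

/-! ### Coupling distances from lattice coordinates -/

/-- `‖triEmbed v‖ ≤ |v₀| + |v₁|` (`|ζ| = 1`). -/
theorem siteEnd_norm_triEmbed_le (v : Site 2) : ‖triEmbed v‖ ≤ |(v 0 : ℝ)| + |(v 1 : ℝ)| := by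
  have hz : ‖triZeta‖ = 1 := by
    rw [Complex.norm_def, normSq_triZeta, Real.sqrt_one]
  rw [triEmbed]
  calc ‖((v 0 : ℤ) : ℂ) + ((v 1 : ℤ) : ℂ) * triZeta‖ ≤ ‖((v 0 : ℤ) : ℂ)‖ + ‖((v 1 : ℤ) : ℂ) * triZeta‖ :=
        norm_add_le _ _
    _ = |(v 0 : ℝ)| + |(v 1 : ℝ)| := by
        rw [norm_mul, hz, mul_one, Complex.norm_intCast, Complex.norm_intCast]

/-- `‖1 + ζ‖ ≤ 2` (`= √3`). -/
theorem siteEnd_norm_one_add_triZeta_le : ‖(1 : ℂ) + triZeta‖ ≤ 2 := by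
  have h : normSq ((1 : ℂ) + triZeta) = 3 := by
    have := normSq_add_mul_triZeta 1 1
    push_cast at this
    rw [one_mul] at this
    rw [this]; norm_num
  rw [Complex.norm_def, h]
  rw [show (2 : ℝ) = Real.sqrt 4 by rw [show (4 : ℝ) = 2 ^ 2 by norm_num, Real.sqrt_sq (by norm_num)]]
  exact Real.sqrt_le_sqrt (by norm_num)

/-- **Coupling distances from lattice coordinates.** The doubled centre of the coarse face
`F = (X, A)` and the centre of the fine face `f = (y, b)` are within
`|y₀ - 2X₀| + |y₁ - 2X₁| + 2`: a combinatorial coupling keeping the fine cell `y` within a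
bounded box around the doubled coarse cell `2X` yields the metric hypothesis of (CFT1)/(CFT0). -/
theorem siteEnd_dist_two_hexCenter_le (F f : HexVertex) :
    dist (2 * hexCenter F) (hexCenter f) ≤
      |(f.1 0 : ℝ) - 2 * F.1 0| + |(f.1 1 : ℝ) - 2 * F.1 1| + 2 := by
  obtain ⟨X, A⟩ := F
  obtain ⟨y, b⟩ := f
  simp only
  have e : hexCenter (y, b) - 2 * hexCenter (X, A) =
      triEmbed (y - 2 • X) + (((b : ℕ) : ℂ) + 1 - 2 * (((A : ℕ) : ℂ) + 1)) * (1 + triZeta) / 3 := by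
    simp only [hexCenter, triEmbed_sub]
    rw [show triEmbed (2 • X) = 2 * triEmbed X by
      rw [two_nsmul, triEmbed_add, two_mul]]
    ring
  rw [dist_comm, dist_eq_norm, e]
  have hcoef : ‖(((b : ℕ) : ℂ) + 1 - 2 * (((A : ℕ) : ℂ) + 1))‖ ≤ 3 := by
    have hb : (b : ℕ) ≤ 1 := Nat.lt_succ_iff.1 b.2
    have hA : (A : ℕ) ≤ 1 := Nat.lt_succ_iff.1 A.2
    have : (((b : ℕ) : ℂ) + 1 - 2 * (((A : ℕ) : ℂ) + 1)) = (((b : ℕ) + 1 - 2 * ((A : ℕ) + 1) : ℝ) : ℂ) := by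
      push_cast; ring
    rw [this, Complex.norm_real, Real.norm_eq_abs, abs_le]
    constructor
    · have : (0 : ℝ) ≤ b := Nat.cast_nonneg _
      have : (A : ℝ) ≤ 1 := by exact_mod_cast hA
      linarith
    · have : (b : ℝ) ≤ 1 := by exact_mod_cast hb
      have : (0 : ℝ) ≤ A := Nat.cast_nonneg _
      linarith
  calc ‖triEmbed (y - 2 • X) + (((b : ℕ) : ℂ) + 1 - 2 * (((A : ℕ) : ℂ) + 1)) * (1 + triZeta) / 3‖
      ≤ ‖triEmbed (y - 2 • X)‖ + ‖(((b : ℕ) : ℂ) + 1 - 2 * (((A : ℕ) : ℂ) + 1)) * (1 + triZeta) / 3‖ :=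
        norm_add_le _ _
    _ ≤ (|((y - 2 • X) 0 : ℝ)| + |((y - 2 • X) 1 : ℝ)|) + 3 * 2 / 3 := by
        refine add_le_add (siteEnd_norm_triEmbed_le _) ?_
        rw [norm_div, norm_mul, Complex.norm_ofNat]
        refine div_le_div_of_nonneg_right ?_ (by norm_num)
        exact mul_le_mul hcoef siteEnd_norm_one_add_triZeta_le (norm_nonneg _) (by norm_num)
    _ = |(y 0 : ℝ) - 2 * X 0| + |(y 1 : ℝ) - 2 * X 1| + 2 := by
        simp only [Pi.sub_apply, Pi.smul_apply, Int.cast_sub]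
        norm_num


/-! ### From a combinatorial fellow-travelling to the metric core (M1)/(M0) -/

/-- Rescaling identity: `dist (δ p) ((δ/2) q) = (δ/2) · dist (2p) q`. -/
theorem siteEnd_dist_smul_half (δ : ℝ) (hδ : 0 ≤ δ) (p q : ℂ) :
    dist ((δ : ℂ) * p) (((δ / 2 : ℝ) : ℂ) * q) = δ / 2 * dist (2 * p) q := by
  rw [dist_eq_norm, dist_eq_norm]
  have e : (δ : ℂ) * p - ((δ / 2 : ℝ) : ℂ) * q = ((δ / 2 : ℝ) : ℂ) * (2 * p - q) := by
    push_cast; ring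
  rw [e, norm_mul, Complex.norm_real, Real.norm_of_nonneg (by linarith)]

/-- **The metric core from a combinatorial fellow-travelling.** If a closed honeycomb walk `Γ`
(drawn at mesh `δ`) and a rebasing `γ'` of the closed walk `γ` (drawn at mesh `δ/2`, same
unbased loop) admit unit-step index sequences along which the doubled coarse face centre
`2 · hexCenter` and the fine face centre `hexCenter` stay within `C` (lattice units), then the
two unbased loops are within `d ≤ (C/2) δ` (`siteEnd_udist_siteLoopCurve_le_of_coupling`). -/
theorem siteEnd_udist_le_of_lattice_coupling {F f f' : HexVertex} (Γ : hexGraph.Walk F F)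
    (γ : hexGraph.Walk f f) (γ' : hexGraph.Walk f' f') {δ C : ℝ} (hδ : 0 < δ) (hC : 0 ≤ C)
    (heq : UnbasedLoop.mk (BasedLoop.mk (siteLoopCurve (δ / 2) γ') (isLoop_siteLoopCurve (δ / 2) γ')) =
      UnbasedLoop.mk (BasedLoop.mk (siteLoopCurve (δ / 2) γ) (isLoop_siteLoopCurve (δ / 2) γ)))
    {K : ℕ} {i j : ℕ → ℕ} (hi0 : i 0 = 0) (hj0 : j 0 = 0) (hiK : i K = Γ.length) (hjK : j K = γ'.length)
    (histep : ∀ k < K, i (k + 1) = i k ∨ i (k + 1) = i k + 1)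
    (hjstep : ∀ k < K, j (k + 1) = j k ∨ j (k + 1) = j k + 1)
    (hdist : ∀ k ≤ K, dist (2 * hexCenter (Γ.getVert (i k))) (hexCenter (γ'.getVert (j k))) ≤ C) :
    (UnbasedLoop.mk (BasedLoop.mk (siteLoopCurve δ Γ) (isLoop_siteLoopCurve δ Γ))).udist
      (UnbasedLoop.mk (BasedLoop.mk (siteLoopCurve (δ / 2) γ) (isLoop_siteLoopCurve (δ / 2) γ))) ≤
      C / 2 * δ := by
  rw [← heq]
  refine siteEnd_udist_siteLoopCurve_le_of_coupling Γ γ' δ (δ / 2) hi0 hj0 hiK hjK histep hjstep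
    (by positivity) fun k hk => ?_
  rw [siteEnd_dist_smul_half δ hδ.le]
  calc δ / 2 * dist (2 * hexCenter (Γ.getVert (i k))) (hexCenter (γ'.getVert (j k))) ≤ δ / 2 * C :=
        mul_le_mul_of_nonneg_left (hdist k hk) (by linarith)
    _ = C / 2 * δ := by ring

/-- **(M1) from the combinatorial fellow-travelling (CFT1) of type-`1` loops.** It remains to
prove (CFT1): for a type-`1` interface loop `Γ` of `τ` and a type-`1` interface loop `γ` of the
blow-up `β τ` whose left cluster contains the block centre of the first left site of `Γ`, some
rebasing `γ'` of `γ` and `Γ` admit a unit-step coupling of their face sequences with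
`dist (2 · hexCenter Γ_{i_k}) (hexCenter γ'_{j_k}) ≤ C`, uniformly. -/
theorem siteEnd_metric_one_of_cft :
    (∃ C : ℝ, ∀ (τ : SiteConfig (Site 2)) {F : HexVertex} {Γ : hexGraph.Walk F F}
      (hΓ : IsSiteInterfaceLoop τ Γ) {f : HexVertex} {γ : hexGraph.Walk f f}
      (hγ : IsSiteInterfaceLoop {v : Site 2 | (∀ j, (2 : ℤ) ∣ v j) ∨ (fun j => v j / 2) ∈ τ} γ),
      0 < shoelace (Γ.support.map hexCenter) → 0 < shoelace (γ.support.map hexCenter) →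
      PathIn triGraph {v : Site 2 | (∀ j, (2 : ℤ) ∣ v j) ∨ (fun j => v j / 2) ∈ τ}
        (fun j => 2 * hΓ.lv 0 j + 1) (hγ.lv 0) →
      ∃ (f' : HexVertex) (γ' : hexGraph.Walk f' f'),
        (∀ δ : ℝ, UnbasedLoop.mk (BasedLoop.mk (siteLoopCurve δ γ') (isLoop_siteLoopCurve δ γ')) =
          UnbasedLoop.mk (BasedLoop.mk (siteLoopCurve δ γ) (isLoop_siteLoopCurve δ γ))) ∧
        ∃ (K : ℕ) (i j : ℕ → ℕ), i 0 = 0 ∧ j 0 = 0 ∧ i K = Γ.length ∧ j K = γ'.length ∧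
          (∀ k < K, i (k + 1) = i k ∨ i (k + 1) = i k + 1) ∧
          (∀ k < K, j (k + 1) = j k ∨ j (k + 1) = j k + 1) ∧
          ∀ k ≤ K, dist (2 * hexCenter (Γ.getVert (i k))) (hexCenter (γ'.getVert (j k))) ≤ C) →
    ∃ C : ℝ, ∀ δ : ℝ, 0 < δ → ∀ (τ : SiteConfig (Site 2)) {F : HexVertex} {Γ : hexGraph.Walk F F}
      (hΓ : IsSiteInterfaceLoop τ Γ) {f : HexVertex} {γ : hexGraph.Walk f f}
      (hγ : IsSiteInterfaceLoop {v : Site 2 | (∀ j, (2 : ℤ) ∣ v j) ∨ (fun j => v j / 2) ∈ τ} γ),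
      0 < shoelace (Γ.support.map hexCenter) → 0 < shoelace (γ.support.map hexCenter) →
      PathIn triGraph {v : Site 2 | (∀ j, (2 : ℤ) ∣ v j) ∨ (fun j => v j / 2) ∈ τ}
        (fun j => 2 * hΓ.lv 0 j + 1) (hγ.lv 0) →
      (UnbasedLoop.mk (BasedLoop.mk (siteLoopCurve δ Γ) (isLoop_siteLoopCurve δ Γ))).udist
        (UnbasedLoop.mk (BasedLoop.mk (siteLoopCurve (δ / 2) γ) (isLoop_siteLoopCurve (δ / 2) γ))) ≤
        C * δ := by
  rintro ⟨C, hC⟩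
  refine ⟨max C 0 / 2, fun δ hδ τ F Γ hΓ f γ hγ h₁ h₂ hp => ?_⟩
  obtain ⟨f', γ', heq, K, i, j, hi0, hj0, hiK, hjK, histep, hjstep, hdist⟩ := hC τ hΓ hγ h₁ h₂ hp
  exact siteEnd_udist_le_of_lattice_coupling Γ γ γ' hδ (le_max_right _ _) (heq (δ / 2)) hi0 hj0 hiK hjK
    histep hjstep fun k hk => (hdist k hk).trans (le_max_left _ _)

/-- **(M0) from the combinatorial fellow-travelling (CFT0) of type-`0` loops** (same, with
right/closed clusters). -/
theorem siteEnd_metric_zero_of_cft :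
    (∃ C : ℝ, ∀ (τ : SiteConfig (Site 2)) {F : HexVertex} {Γ : hexGraph.Walk F F}
      (hΓ : IsSiteInterfaceLoop τ Γ) {f : HexVertex} {γ : hexGraph.Walk f f}
      (hγ : IsSiteInterfaceLoop {v : Site 2 | (∀ j, (2 : ℤ) ∣ v j) ∨ (fun j => v j / 2) ∈ τ} γ),
      shoelace (Γ.support.map hexCenter) ≤ 0 → shoelace (γ.support.map hexCenter) ≤ 0 →
      PathIn triGraph {v : Site 2 | (∀ j, (2 : ℤ) ∣ v j) ∨ (fun j => v j / 2) ∈ τ}ᶜ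
        (fun j => 2 * hΓ.rv 0 j + 1) (hγ.rv 0) →
      ∃ (f' : HexVertex) (γ' : hexGraph.Walk f' f'),
        (∀ δ : ℝ, UnbasedLoop.mk (BasedLoop.mk (siteLoopCurve δ γ') (isLoop_siteLoopCurve δ γ')) =
          UnbasedLoop.mk (BasedLoop.mk (siteLoopCurve δ γ) (isLoop_siteLoopCurve δ γ))) ∧
        ∃ (K : ℕ) (i j : ℕ → ℕ), i 0 = 0 ∧ j 0 = 0 ∧ i K = Γ.length ∧ j K = γ'.length ∧
          (∀ k < K, i (k + 1) = i k ∨ i (k + 1) = i k + 1) ∧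
          (∀ k < K, j (k + 1) = j k ∨ j (k + 1) = j k + 1) ∧
          ∀ k ≤ K, dist (2 * hexCenter (Γ.getVert (i k))) (hexCenter (γ'.getVert (j k))) ≤ C) →
    ∃ C : ℝ, ∀ δ : ℝ, 0 < δ → ∀ (τ : SiteConfig (Site 2)) {F : HexVertex} {Γ : hexGraph.Walk F F}
      (hΓ : IsSiteInterfaceLoop τ Γ) {f : HexVertex} {γ : hexGraph.Walk f f}
      (hγ : IsSiteInterfaceLoop {v : Site 2 | (∀ j, (2 : ℤ) ∣ v j) ∨ (fun j => v j / 2) ∈ τ} γ),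
      shoelace (Γ.support.map hexCenter) ≤ 0 → shoelace (γ.support.map hexCenter) ≤ 0 →
      PathIn triGraph {v : Site 2 | (∀ j, (2 : ℤ) ∣ v j) ∨ (fun j => v j / 2) ∈ τ}ᶜ
        (fun j => 2 * hΓ.rv 0 j + 1) (hγ.rv 0) →
      (UnbasedLoop.mk (BasedLoop.mk (siteLoopCurve δ Γ) (isLoop_siteLoopCurve δ Γ))).udist
        (UnbasedLoop.mk (BasedLoop.mk (siteLoopCurve (δ / 2) γ) (isLoop_siteLoopCurve (δ / 2) γ))) ≤
        C * δ := by
  rintro ⟨C, hC⟩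
  refine ⟨max C 0 / 2, fun δ hδ τ F Γ hΓ f γ hγ h₁ h₂ hp => ?_⟩
  obtain ⟨f', γ', heq, K, i, j, hi0, hj0, hiK, hjK, histep, hjstep, hdist⟩ := hC τ hΓ hγ h₁ h₂ hp
  exact siteEnd_udist_le_of_lattice_coupling Γ γ γ' hδ (le_max_right _ _) (heq (δ / 2)) hi0 hj0 hiK hjK
    histep hjstep fun k hk => (hdist k hk).trans (le_max_left _ _)

/-! ### A concrete dart of the fine outer boundary -/

/-- **The fine type-`1` loop crosses the edge to the right of the pendant corner `2(c + e₀)`.**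
If `c` is a rightmost cell (maximal first coordinate) of the left cluster of the type-`1` loop
`Γ` of `τ`, and `γ` is a type-`1` loop of the blow-up whose left cluster contains the block
centre of `lv₀(Γ)`, then the pendant corner `2c + (2,0)` is a rightmost site of the left cluster
of `γ` and `γ` contains the hexagon dart `hexDart (2c + (2,0)) 5` (crossing towards
`2c + (3,0)`, a closed site of the block of the closed cell `c + e₀`): a synchronised pair of
starting darts (`hexDart c 5 ∈ Γ.darts`, `siteEnd_hexDart_mem_darts`) for the fellow-travelling
(CFT1). -/
theorem siteEnd_fine_hexDart_mem_darts {τ : SiteConfig (Site 2)} {F : HexVertex} {Γ : hexGraph.Walk F F}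
    (hΓ : IsSiteInterfaceLoop τ Γ) {f : HexVertex} {γ : hexGraph.Walk f f}
    (hγ : IsSiteInterfaceLoop {v : Site 2 | (∀ j, (2 : ℤ) ∣ v j) ∨ (fun j => v j / 2) ∈ τ} γ)
    (hγpos : 0 < shoelace (γ.support.map hexCenter))
    (hp : PathIn triGraph {v : Site 2 | (∀ j, (2 : ℤ) ∣ v j) ∨ (fun j => v j / 2) ∈ τ}
      (fun j => 2 * hΓ.lv 0 j + 1) (hγ.lv 0))
    {c : Site 2} (hc : PathIn triGraph τ (hΓ.lv 0) c) (hmax : ∀ x, PathIn triGraph τ (hΓ.lv 0) x → x 0 ≤ c 0) :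
    hexDart (![2 * c 0 + 2, 2 * c 1] : Site 2) 5 ∈ γ.darts := by
  set A : Set (Site 2) := {v : Site 2 | (∀ j, (2 : ℤ) ∣ v j) ∨ (fun j => v j / 2) ∈ τ} with hA
  set c' : Site 2 := ![2 * c 0 + 2, 2 * c 1] with hc'
  have hc'0 : c' 0 = 2 * c 0 + 2 := rfl
  have hc'1 : c' 1 = 2 * c 1 := rfl
  have hc'even : ∀ j, (2 : ℤ) ∣ c' j := fun j => by
    fin_cases j
    · exact ⟨c 0 + 1, show c' 0 = _ by rw [hc'0]; ring⟩
    · exact ⟨c 1, show c' 1 = _ by rw [hc'1]⟩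
  have hc'A : c' ∈ A := Or.inl hc'even
  -- the corner `c'` hangs on the centre of the block of `c`
  have hctr : PathIn triGraph A (fun j => 2 * c j + 1) c' :=
    PathIn.of_adj ((siteEnd_ctr_mem_blowup_iff τ c).2 hc.right_mem) hc'A
      (siteEnd_adj_of_coords' rfl rfl hc'0 hc'1 (by omega))
  -- `c'` lies in the left cluster of `γ`
  have hc'C : PathIn triGraph A (hγ.lv 0) c' :=
    (hp.symm.trans (siteEnd_pathIn_blowup_of_pathIn hc)).trans hctr
  refine siteEnd_hexDart_mem_darts hγ hγpos hc'C fun v hv => ?_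
  -- maximality of the first coordinate of `c'` over the left cluster of `γ`
  have hv' : PathIn triGraph A (fun j => 2 * hΓ.lv 0 j + 1) v := hp.trans hv
  rw [hc'0]
  by_cases hve : ∀ j, (2 : ℤ) ∣ v j
  · obtain ⟨u, hu, hunc, huv⟩ := siteEnd_exists_adj_of_pathIn_blowup_even hv' hve
    have hux : PathIn triGraph τ (hΓ.lv 0) (fun j => u j / 2) := by
      have := siteEnd_pathIn_of_pathIn_blowup hu (siteEnd_ctr_not_even _) hunc
      rwa [siteEnd_half_ctr] at this
    have h1 := hmax _ hux
    have h2 := siteEnd_half_of_adj_even huv hve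
    obtain ⟨a, ha⟩ := hve 0
    omega
  · have hvx : PathIn triGraph τ (hΓ.lv 0) (fun j => v j / 2) := by
      have := siteEnd_pathIn_of_pathIn_blowup hv' (siteEnd_ctr_not_even _) hve
      rwa [siteEnd_half_ctr] at this
    have h1 := hmax _ hvx
    omega

/-- **S2 from the combinatorial fellow-travelling.** `SiteEndLoops` follows from (CFT1) and
(CFT0) (`siteEnd_metric_one_of_cft`, `siteEnd_metric_zero_of_cft`, `siteEnd_of_metric`). -/
theorem siteEnd_of_cft :
    (∃ C : ℝ, ∀ (τ : SiteConfig (Site 2)) {F : HexVertex} {Γ : hexGraph.Walk F F}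
      (hΓ : IsSiteInterfaceLoop τ Γ) {f : HexVertex} {γ : hexGraph.Walk f f}
      (hγ : IsSiteInterfaceLoop {v : Site 2 | (∀ j, (2 : ℤ) ∣ v j) ∨ (fun j => v j / 2) ∈ τ} γ),
      0 < shoelace (Γ.support.map hexCenter) → 0 < shoelace (γ.support.map hexCenter) →
      PathIn triGraph {v : Site 2 | (∀ j, (2 : ℤ) ∣ v j) ∨ (fun j => v j / 2) ∈ τ}
        (fun j => 2 * hΓ.lv 0 j + 1) (hγ.lv 0) →
      ∃ (f' : HexVertex) (γ' : hexGraph.Walk f' f'),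
        (∀ δ : ℝ, UnbasedLoop.mk (BasedLoop.mk (siteLoopCurve δ γ') (isLoop_siteLoopCurve δ γ')) =
          UnbasedLoop.mk (BasedLoop.mk (siteLoopCurve δ γ) (isLoop_siteLoopCurve δ γ))) ∧
        ∃ (K : ℕ) (i j : ℕ → ℕ), i 0 = 0 ∧ j 0 = 0 ∧ i K = Γ.length ∧ j K = γ'.length ∧
          (∀ k < K, i (k + 1) = i k ∨ i (k + 1) = i k + 1) ∧
          (∀ k < K, j (k + 1) = j k ∨ j (k + 1) = j k + 1) ∧
          ∀ k ≤ K, dist (2 * hexCenter (Γ.getVert (i k))) (hexCenter (γ'.getVert (j k))) ≤ C) →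
    (∃ C : ℝ, ∀ (τ : SiteConfig (Site 2)) {F : HexVertex} {Γ : hexGraph.Walk F F}
      (hΓ : IsSiteInterfaceLoop τ Γ) {f : HexVertex} {γ : hexGraph.Walk f f}
      (hγ : IsSiteInterfaceLoop {v : Site 2 | (∀ j, (2 : ℤ) ∣ v j) ∨ (fun j => v j / 2) ∈ τ} γ),
      shoelace (Γ.support.map hexCenter) ≤ 0 → shoelace (γ.support.map hexCenter) ≤ 0 →
      PathIn triGraph {v : Site 2 | (∀ j, (2 : ℤ) ∣ v j) ∨ (fun j => v j / 2) ∈ τ}ᶜ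
        (fun j => 2 * hΓ.rv 0 j + 1) (hγ.rv 0) →
      ∃ (f' : HexVertex) (γ' : hexGraph.Walk f' f'),
        (∀ δ : ℝ, UnbasedLoop.mk (BasedLoop.mk (siteLoopCurve δ γ') (isLoop_siteLoopCurve δ γ')) =
          UnbasedLoop.mk (BasedLoop.mk (siteLoopCurve δ γ) (isLoop_siteLoopCurve δ γ))) ∧
        ∃ (K : ℕ) (i j : ℕ → ℕ), i 0 = 0 ∧ j 0 = 0 ∧ i K = Γ.length ∧ j K = γ'.length ∧
          (∀ k < K, i (k + 1) = i k ∨ i (k + 1) = i k + 1) ∧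
          (∀ k < K, j (k + 1) = j k ∨ j (k + 1) = j k + 1) ∧
          ∀ k ≤ K, dist (2 * hexCenter (Γ.getVert (i k))) (hexCenter (γ'.getVert (j k))) ≤ C) →
    SiteEndLoops :=
  fun h1 h0 => siteEnd_of_metric (siteEnd_metric_one_of_cft h1) (siteEnd_metric_zero_of_cft h0)

end Summit.CriticalPhenomena.CardyFormulaZ2.Cruxes.LoopLimitZ2EqT.HexSegment

end
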